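import Summits.PneNP.PneNP.Theorems.SzkEntropyPeaThreeNotInPLatticeDefs
import Mathlib.Analysis.Convex.SpecificFunctions.Basic
import HarnessLib

/-!
# Route SzkEntropy, crux `PeaThreeNotInP` (stmt-PneNP-10776), line `SketchIdeator3`, socket client
# `lattice-cube-smoothing`: stub `stub_overlap` (W5), the overlap of the two translates

If `K t = K·(z₀ B) + w` with `32 n |z₀ᵢ| ≤ 2^ℓ`, `4 |wᵢ| ≤ 3 M` and `32 Σ|wᵢ| ≤ 33 M` (`M = 2^m`), the
pairing `(z, e) ↦ (z + z₀, e + w)` is injective on the sub-box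
`Ω = {(z, e) : z + z₀ ∈ [0, 2^ℓ)ⁿ, e + w ∈ [0, M)ⁿ}` and carries the translate `f = g + K t` to `g`
there, so `Σ_y min(#f⁻¹ y, #g⁻¹ y) ≥ |Ω| = Π (2^ℓ − |z₀ᵢ|) Π (M − |wᵢ|)`.  The elementary bounds
`Π (1 − bᵢ) ≥ 1 − Σ bᵢ ≥ 31/32` (`bᵢ = |z₀ᵢ| / 2^ℓ ≤ 1/(32 n)`) and
`Π (1 − aᵢ) ≥ 2^{-(8/3) Σ aᵢ} ≥ 2^{-(8/3)(33/32)} ≥ 1/8` (`aᵢ = |wᵢ| / M ∈ [0, 3/4]`, from the convexity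
bound `2^{-(8/3) x} ≤ 1 − x` on `[0, 3/4]`) give `|Ω| ≥ |Box| · 31/256 ≥ |Box| / 10`.

References: O. Goldreich, S. Goldwasser, J. Comput. Syst. Sci. 60 (2000) §3 (overlap of the two
translated balls / boxes in the `GapCVP` protocol).
-/

namespace Summit.PneNP.PneNP.Cruxes.PeaThreeNotInP.LatticeLine

set_option linter.dupNamespace false -- `Summit.PneNP.PneNP.…`: summit = sub-problem name (D-0017)

open Finset

/-! ### Counting: overlap from a partial pairing -/

/-- **Overlap from a partial pairing.** If `φ` is injective on `Ω` and `g ∘ φ = f` on `Ω`, then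
`|Ω| ≤ Σ_{y ∈ f(univ)} min (#f⁻¹ y) (#g⁻¹ y)`: decompose `Ω` along the fibres of `f`; the fibre piece
`Ω ∩ f⁻¹ y` lies in `f⁻¹ y` and is mapped injectively into `g⁻¹ y` by `φ`. [folklore] -/
theorem ovl_card_le_sum_min {ι β : Type*} [Fintype ι] [DecidableEq β] (f g : ι → β) (Ω : Finset ι)
    (φ : ι → ι) (hφ : Set.InjOn φ Ω) (hfg : ∀ x ∈ Ω, g (φ x) = f x) :
    ((Ω.card : ℕ) : ℝ) ≤ ∑ y ∈ (univ : Finset ι).image f,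
      (min (univ.filter fun i => f i = y).card (univ.filter fun i => g i = y).card : ℝ) := by
  have hmaps : Set.MapsTo f ↑Ω ↑((univ : Finset ι).image f) :=
    fun x _ => mem_coe.2 (mem_image_of_mem f (mem_univ x))
  rw [card_eq_sum_card_fiberwise hmaps, Nat.cast_sum]
  refine sum_le_sum fun y _ => le_min ?_ ?_
  · exact_mod_cast card_le_card (filter_subset_filter _ (subset_univ Ω))
  · classical
    have hsub : (↑(Ω.filter fun i => f i = y) : Set ι) ⊆ ↑Ω := coe_subset.2 (filter_subset _ _)
    rw [← card_image_of_injOn (hφ.mono hsub)]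
    refine Nat.cast_le.2 (card_le_card fun j hj => ?_)
    simp only [mem_image, mem_filter, mem_univ, true_and] at hj ⊢
    obtain ⟨x, ⟨hx, hfx⟩, rfl⟩ := hj
    rw [hfg x hx, hfx]

/-! ### Counting: a shifted residue window -/

/-- **A shifted residue window.** For an integer shift `s`, at least `N − |s|` residues `v < N`
satisfy `0 ≤ v + s < N` (the window `[max(0,−s), min(N, N−s))`). [folklore] -/
theorem ovl_shift_card (N : ℕ) (s : ℤ) :
    N - s.natAbs ≤ (univ.filter fun v : Fin N => 0 ≤ ((v : ℕ) : ℤ) + s ∧ ((v : ℕ) : ℤ) + s < N).card := by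
  rw [← Finset.card_range (N - s.natAbs)]
  obtain ⟨k, rfl | rfl⟩ := Int.eq_nat_or_neg s
  · refine card_le_card_of_surjOn (fun v : Fin N => (v : ℕ)) fun j hj => ?_
    rw [coe_range, Set.mem_Iio, Int.natAbs_natCast] at hj
    refine ⟨⟨j, by omega⟩, ?_, rfl⟩
    simp only [mem_coe, mem_filter, mem_univ, true_and]
    constructor <;> omega
  · refine card_le_card_of_surjOn (fun v : Fin N => (v : ℕ) - k) fun j hj => ?_
    rw [coe_range, Set.mem_Iio, Int.natAbs_neg, Int.natAbs_natCast] at hj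
    refine ⟨⟨j + k, by omega⟩, ?_, by simp⟩
    simp only [mem_coe, mem_filter, mem_univ, true_and]
    constructor <;> omega

/-- The shifted residue window, real form: `N − |s| ≤ #{v < N : 0 ≤ v + s < N}`. [folklore] -/
theorem ovl_shift_card_real (N : ℕ) (s : ℤ) :
    (N : ℝ) - |(s : ℝ)| ≤
      ((univ.filter fun v : Fin N => 0 ≤ ((v : ℕ) : ℤ) + s ∧ ((v : ℕ) : ℤ) + s < N).card : ℝ) := by
  have h := ovl_shift_card N s
  have habs : ((s.natAbs : ℕ) : ℝ) = |(s : ℝ)| := by rw [Nat.cast_natAbs, Int.cast_abs]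
  rw [← habs]
  calc (N : ℝ) - (s.natAbs : ℕ) ≤ ((N - s.natAbs : ℕ) : ℝ) := by
        rw [sub_le_iff_le_add]; exact_mod_cast le_tsub_add
    _ ≤ _ := by exact_mod_cast h

/-- On the window `0 ≤ v + s < N` the reduced shift `(v + s)⁺ mod N` is `v + s`. [folklore] -/
theorem ovl_val_shift (N v : ℕ) (s : ℤ) (h0 : 0 ≤ (v : ℤ) + s) (h1 : (v : ℤ) + s < N) :
    (((((v : ℤ) + s).toNat % N : ℕ)) : ℤ) = (v : ℤ) + s := by
  rw [Nat.mod_eq_of_lt ((Int.toNat_lt h0).2 h1), Int.toNat_of_nonneg h0]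

/-! ### The pairing `(z, e) ↦ (z + z₀, e + w)` -/

/-- **The pairing.** With `K t = K·(z₀ B) + w`, the sub-box
`Ω = {(z, e) : z + z₀ ∈ [0, 2^ℓ)ⁿ, e + w ∈ [0, 2^m)ⁿ}` (a product of shifted windows) satisfies
`|Ω| ≤ Σ_y min (#f⁻¹ y) (#g⁻¹ y)` for `f = sampF`, `g = sampG`: the shift `(z, e) ↦ (z + z₀, e + w)` is
injective on `Ω` and `g (z + z₀, e + w) = g (z, e) + K t = f (z, e)`. [cite: GoldreichGoldwasser2000, §3] -/
theorem ovl_pairing (n ℓ m : ℕ) (K : ℤ) (B : Matrix (Fin n) (Fin n) ℤ) (t z₀ w : Fin n → ℤ)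
    (hdec : ∀ i, K * t i = (∑ i', K * B i' i * z₀ i') + w i) :
    ((((Fintype.piFinset fun i : Fin n => univ.filter fun v : Fin (2 ^ ℓ) =>
          0 ≤ ((v : ℕ) : ℤ) + z₀ i ∧ ((v : ℕ) : ℤ) + z₀ i < ((2 ^ ℓ : ℕ) : ℤ)) ×ˢ
        (Fintype.piFinset fun i : Fin n => univ.filter fun v : Fin (2 ^ m) =>
          0 ≤ ((v : ℕ) : ℤ) + w i ∧ ((v : ℕ) : ℤ) + w i < ((2 ^ m : ℕ) : ℤ))).card : ℕ) : ℝ) ≤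
      ∑ y ∈ (univ : Finset (Box n ℓ m)).image (sampF n K B t),
        (min (univ.filter fun ze : Box n ℓ m => sampF n K B t ze = y).card
          (univ.filter fun ze : Box n ℓ m => sampG n K B ze = y).card : ℝ) := by
  refine ovl_card_le_sum_min (sampF n K B t) (sampG n K B) _
    (fun ze => (fun i => ⟨((((ze.1 i : ℕ) : ℤ) + z₀ i).toNat) % 2 ^ ℓ, Nat.mod_lt _ (Nat.two_pow_pos ℓ)⟩,
      fun i => ⟨((((ze.2 i : ℕ) : ℤ) + w i).toNat) % 2 ^ m, Nat.mod_lt _ (Nat.two_pow_pos m)⟩)) ?_ ?_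
  · -- injective on `Ω`
    rintro ⟨z, e⟩ hze ⟨z', e'⟩ hze' heq
    simp only [mem_coe, mem_product, Fintype.mem_piFinset, mem_filter, mem_univ, true_and] at hze hze'
    simp only [Prod.mk.injEq] at heq
    obtain ⟨h1, h2⟩ := heq
    refine Prod.ext (funext fun i => Fin.ext ?_) (funext fun i => Fin.ext ?_)
    · have hi := congr_arg (fun f : Fin n → Fin (2 ^ ℓ) => ((f i : ℕ) : ℤ)) h1
      simp only at hi
      rw [ovl_val_shift _ _ _ (hze.1 i).1 (hze.1 i).2, ovl_val_shift _ _ _ (hze'.1 i).1 (hze'.1 i).2] at hi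
      exact_mod_cast add_right_cancel hi
    · have hi := congr_arg (fun f : Fin n → Fin (2 ^ m) => ((f i : ℕ) : ℤ)) h2
      simp only at hi
      rw [ovl_val_shift _ _ _ (hze.2 i).1 (hze.2 i).2, ovl_val_shift _ _ _ (hze'.2 i).1 (hze'.2 i).2] at hi
      exact_mod_cast add_right_cancel hi
  · -- `g ∘ φ = f` on `Ω`
    rintro ⟨z, e⟩ hze
    simp only [mem_product, Fintype.mem_piFinset, mem_filter, mem_univ, true_and] at hze
    have hzv : ∀ i', (((((z i' : ℕ) : ℤ) + z₀ i').toNat % 2 ^ ℓ : ℕ) : ℤ) = ((z i' : ℕ) : ℤ) + z₀ i' :=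
      fun i' => ovl_val_shift _ _ _ (hze.1 i').1 (hze.1 i').2
    have hev : ∀ i, (((((e i : ℕ) : ℤ) + w i).toNat % 2 ^ m : ℕ) : ℤ) = ((e i : ℕ) : ℤ) + w i :=
      fun i => ovl_val_shift _ _ _ (hze.2 i).1 (hze.2 i).2
    funext i
    simp only [sampF, sampG, hzv, hev, hdec i, mul_add, sum_add_distrib]
    ring

/-! ### Elementary real inequalities -/

/-- `e^{-(8/3)(log 2) x} ≤ 1 − x` on `[0, 3/4]`: the left side is convex in `x`, equals `1` at
`x = 0` and `2^{-2} = 1/4 = 1 − 3/4` at `x = 3/4`. [folklore] -/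
theorem ovl_exp_le_one_sub {x : ℝ} (h0 : 0 ≤ x) (h1 : x ≤ 3 / 4) :
    Real.exp (-(8 / 3 * Real.log 2 * x)) ≤ 1 - x := by
  have h4 : Real.exp (-(2 * Real.log 2)) = 1 / 4 := by
    rw [Real.exp_neg, show (2 : ℝ) * Real.log 2 = ((2 : ℕ) : ℝ) * Real.log 2 by norm_num,
      Real.exp_nat_mul, Real.exp_log two_pos]
    norm_num
  have hθ0 : 0 ≤ 4 / 3 * x := by positivity
  have hθ1 : 4 / 3 * x ≤ 1 := by linarith
  have key := convexOn_exp.2 (Set.mem_univ 0) (Set.mem_univ (-(2 * Real.log 2))) (sub_nonneg.2 hθ1) hθ0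
    (sub_add_cancel 1 (4 / 3 * x))
  simp only [smul_eq_mul, mul_zero, zero_add, Real.exp_zero, mul_one, h4] at key
  have e : 4 / 3 * x * -(2 * Real.log 2) = -(8 / 3 * Real.log 2 * x) := by ring
  rw [e] at key
  linarith

/-- `e^{-(8/3)(log 2) Σ aᵢ} ≤ ∏ (1 − aᵢ)` for `aᵢ ∈ [0, 3/4]` (termwise `ovl_exp_le_one_sub`). [folklore] -/
theorem ovl_exp_sum_le_prod {ι : Type*} (s : Finset ι) (a : ι → ℝ)
    (h : ∀ i ∈ s, 0 ≤ a i ∧ a i ≤ 3 / 4) :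
    Real.exp (-(8 / 3 * Real.log 2 * ∑ i ∈ s, a i)) ≤ ∏ i ∈ s, (1 - a i) := by
  rw [mul_sum, ← sum_neg_distrib, Real.exp_sum]
  exact prod_le_prod (fun i _ => (Real.exp_pos _).le) fun i hi => ovl_exp_le_one_sub (h i hi).1 (h i hi).2

/-- **Weierstrass' product inequality**: `1 − Σ bᵢ ≤ ∏ (1 − bᵢ)` for `bᵢ ∈ [0, 1]`. [folklore] -/
theorem ovl_one_sub_sum_le_prod {ι : Type*} (s : Finset ι) (b : ι → ℝ)
    (h : ∀ i ∈ s, 0 ≤ b i ∧ b i ≤ 1) : 1 - ∑ i ∈ s, b i ≤ ∏ i ∈ s, (1 - b i) := by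
  -- adapted from Literature/Computability/Complexity/ProductWeights.lean (`one_sub_sum_le_prod_one_sub`)
  classical
  induction s using Finset.induction_on with
  | empty => simp
  | insert a s has ih =>
    rw [sum_insert has, prod_insert has]
    have ih' := ih fun i hi => h i (mem_insert_of_mem hi)
    have ha := h a (mem_insert_self a s)
    have hs0 : 0 ≤ ∑ i ∈ s, b i := sum_nonneg fun i hi => (h i (mem_insert_of_mem hi)).1
    have hprod : (1 - b a) * (1 - ∑ i ∈ s, b i) ≤ (1 - b a) * ∏ i ∈ s, (1 - b i) :=
      mul_le_mul_of_nonneg_left ih' (by linarith)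
    nlinarith

/-- **The box fraction.** If `32 n |z₀ᵢ| ≤ Z`, `4 |wᵢ| ≤ 3 M`, `32 Σ |wᵢ| ≤ 33 M` and
`czᵢ ≥ Z − |z₀ᵢ|`, `cwᵢ ≥ M − |wᵢ|`, then `(∏ czᵢ)(∏ cwᵢ) ≥ Zⁿ Mⁿ · (31/32) · (1/8) ≥ Zⁿ Mⁿ / 10`.
[folklore] -/
theorem ovl_fraction (n Z M : ℕ) (hZ : 0 < Z) (hM : 0 < M) (cz cw : Fin n → ℝ) (z₀ w : Fin n → ℤ)
    (hz : ∀ i, 32 * n * (z₀ i).natAbs ≤ Z) (hw : ∀ i, 4 * (w i).natAbs ≤ 3 * M)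
    (hws : 32 * ∑ i, (w i).natAbs ≤ 33 * M)
    (hcz : ∀ i, (Z : ℝ) - |(z₀ i : ℝ)| ≤ cz i) (hcw : ∀ i, (M : ℝ) - |(w i : ℝ)| ≤ cw i) :
    ((Z ^ n * M ^ n : ℕ) : ℝ) / 10 ≤ (∏ i, cz i) * ∏ i, cw i := by
  have hZ' : (0 : ℝ) < Z := Nat.cast_pos.2 hZ
  have hM' : (0 : ℝ) < M := Nat.cast_pos.2 hM
  have hzR : ∀ i, 32 * (n : ℝ) * |(z₀ i : ℝ)| ≤ Z := fun i => by
    have h := (Nat.cast_le (α := ℝ)).2 (hz i)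
    push_cast [Nat.cast_natAbs, Int.cast_abs] at h
    exact h
  have hwR : ∀ i, 4 * |(w i : ℝ)| ≤ 3 * M := fun i => by
    have h := (Nat.cast_le (α := ℝ)).2 (hw i)
    push_cast [Nat.cast_natAbs, Int.cast_abs] at h
    exact h
  have hwsR : 32 * ∑ i, |(w i : ℝ)| ≤ 33 * M := by
    have h := (Nat.cast_le (α := ℝ)).2 hws
    push_cast [Nat.cast_natAbs, Int.cast_abs] at h
    exact h
  -- the `z`-part: `∏ czᵢ ≥ Zⁿ (1 − Σ bᵢ) ≥ Zⁿ · 31/32`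
  have hb : ∀ i, 0 ≤ |(z₀ i : ℝ)| / Z ∧ |(z₀ i : ℝ)| / Z ≤ 1 := fun i => by
    refine ⟨div_nonneg (abs_nonneg _) hZ'.le, ?_⟩
    rw [div_le_iff₀ hZ', one_mul]
    have hn1 : (1 : ℝ) ≤ n := by
      have : 0 < n := Fin.pos i
      exact_mod_cast this
    nlinarith [hzR i, abs_nonneg (z₀ i : ℝ)]
  have hbsum : ∑ i, |(z₀ i : ℝ)| / Z ≤ 1 / 32 := by
    rcases Nat.eq_zero_or_pos n with hn | hn
    · subst hn
      simp
    · have hn' : (0 : ℝ) < n := Nat.cast_pos.2 hn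
      calc ∑ i, |(z₀ i : ℝ)| / Z ≤ ∑ _i : Fin n, 1 / (32 * (n : ℝ)) := sum_le_sum fun i _ => by
            rw [div_le_div_iff₀ hZ' (by positivity), one_mul]
            linarith [hzR i]
        _ = 1 / 32 := by
            rw [sum_const, card_univ, Fintype.card_fin, nsmul_eq_mul]
            field_simp
  have h1 : (Z : ℝ) ^ n * (31 / 32) ≤ ∏ i, cz i :=
    calc (Z : ℝ) ^ n * (31 / 32) ≤ (Z : ℝ) ^ n * (1 - ∑ i, |(z₀ i : ℝ)| / Z) :=
          mul_le_mul_of_nonneg_left (by linarith) (by positivity)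
      _ ≤ (Z : ℝ) ^ n * ∏ i, (1 - |(z₀ i : ℝ)| / Z) :=
          mul_le_mul_of_nonneg_left (ovl_one_sub_sum_le_prod _ _ fun i _ => hb i) (by positivity)
      _ = ∏ i, ((Z : ℝ) * (1 - |(z₀ i : ℝ)| / Z)) := by
          rw [prod_mul_distrib, prod_const, card_univ, Fintype.card_fin]
      _ ≤ ∏ i, cz i :=
          prod_le_prod (fun i _ => mul_nonneg hZ'.le (sub_nonneg.2 (hb i).2)) fun i _ => by
            have e : (Z : ℝ) * (1 - |(z₀ i : ℝ)| / Z) = Z - |(z₀ i : ℝ)| := by field_simp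
            rw [e]
            exact hcz i
  -- the `e`-part: `∏ cwᵢ ≥ Mⁿ e^{-(8/3) log 2 · Σ aᵢ} ≥ Mⁿ / 8`
  have ha : ∀ i, 0 ≤ |(w i : ℝ)| / M ∧ |(w i : ℝ)| / M ≤ 3 / 4 := fun i =>
    ⟨div_nonneg (abs_nonneg _) hM'.le, by rw [div_le_iff₀ hM']; linarith [hwR i]⟩
  have hasum : ∑ i, |(w i : ℝ)| / M ≤ 33 / 32 := by
    rw [← sum_div, div_le_iff₀ hM']
    linarith [hwsR]
  have h8 : (1 : ℝ) / 8 ≤ Real.exp (-(8 / 3 * Real.log 2 * ∑ i, |(w i : ℝ)| / M)) := by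
    have e8 : Real.exp (-(3 * Real.log 2)) = 1 / 8 := by
      rw [Real.exp_neg, show (3 : ℝ) * Real.log 2 = ((3 : ℕ) : ℝ) * Real.log 2 by norm_num,
        Real.exp_nat_mul, Real.exp_log two_pos]
      norm_num
    rw [← e8, Real.exp_le_exp]
    have hlog : 0 < Real.log 2 := Real.log_pos one_lt_two
    nlinarith [mul_le_mul_of_nonneg_left hasum hlog.le, sum_nonneg fun i (_ : i ∈ univ) => (ha i).1]
  have h2 : (M : ℝ) ^ n * (1 / 8) ≤ ∏ i, cw i :=
    calc (M : ℝ) ^ n * (1 / 8) ≤ (M : ℝ) ^ n * Real.exp (-(8 / 3 * Real.log 2 * ∑ i, |(w i : ℝ)| / M)) :=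
          mul_le_mul_of_nonneg_left h8 (by positivity)
      _ ≤ (M : ℝ) ^ n * ∏ i, (1 - |(w i : ℝ)| / M) :=
          mul_le_mul_of_nonneg_left (ovl_exp_sum_le_prod _ _ fun i _ => ha i) (by positivity)
      _ = ∏ i, ((M : ℝ) * (1 - |(w i : ℝ)| / M)) := by
          rw [prod_mul_distrib, prod_const, card_univ, Fintype.card_fin]
      _ ≤ ∏ i, cw i :=
          prod_le_prod (fun i _ => mul_nonneg hM'.le (by linarith [(ha i).2])) fun i _ => by
            have e : (M : ℝ) * (1 - |(w i : ℝ)| / M) = M - |(w i : ℝ)| := by field_simp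
            rw [e]
            exact hcw i
  -- numbers: `1/10 ≤ (31/32) (1/8) = 31/256`
  have hP : (0 : ℝ) < (Z : ℝ) ^ n * (M : ℝ) ^ n := by positivity
  push_cast
  calc (Z : ℝ) ^ n * (M : ℝ) ^ n / 10 ≤ ((Z : ℝ) ^ n * (31 / 32)) * ((M : ℝ) ^ n * (1 / 8)) := by
        nlinarith [hP]
    _ ≤ (∏ i, cz i) * ∏ i, cw i :=
        mul_le_mul h1 h2 (by positivity) ((by positivity : (0 : ℝ) ≤ (Z : ℝ) ^ n * (31 / 32)).trans h1)

/-! ### The stub -/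

/-- **(W5) Overlap of the two translates.**  If `K t = K·(z₀ B) + w` with `|z₀ᵢ| ≤ 2^ℓ/(32 n)`,
`|wᵢ| ≤ (3/4) M`, `Σ|wᵢ| ≤ (33/32) M`, then the pairing `(z, e) ↦ (z + z₀, e + w)` shows
`Σ_y min(#f⁻¹y, #g⁻¹y) ≥ |Ω'| = Π (2^ℓ − |z₀ᵢ|) Π (M − |wᵢ|) ≥ |Box| · (31/32) · 2^{-(8/3)(33/32)} ≥ |Box| / 10`
(`1 − x ≥ 2^{-(8/3) x}` on `[0, 3/4]`). [cite: GoldreichGoldwasser2000, §3] -/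
theorem stub_overlap (n ℓ m : ℕ) (K : ℤ) (B : Matrix (Fin n) (Fin n) ℤ) (t z₀ w : Fin n → ℤ) (hdec : ∀ i, K * t i = (∑ i', K * B i' i * z₀ i') + w i) (hz : ∀ i, 32 * n * (z₀ i).natAbs ≤ 2 ^ ℓ) (hw : ∀ i, 4 * (w i).natAbs ≤ 3 * 2 ^ m) (hws : 32 * ∑ i, (w i).natAbs ≤ 33 * 2 ^ m) : (Fintype.card (Box n ℓ m) : ℝ) / 10 ≤ ∑ y ∈ (Finset.univ : Finset (Box n ℓ m)).image (sampF n K B t), (min (Finset.univ.filter fun ze : Box n ℓ m => sampF n K B t ze = y).card (Finset.univ.filter fun ze : Box n ℓ m => sampG n K B ze = y).card : ℝ) := by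
  have hbox : Fintype.card (Box n ℓ m) = (2 ^ ℓ) ^ n * (2 ^ m) ^ n := by
    simp [Fintype.card_prod, Fintype.card_fin]
  refine le_trans ?_ (ovl_pairing n ℓ m K B t z₀ w hdec)
  rw [card_product, Fintype.card_piFinset, Fintype.card_piFinset, Nat.cast_mul, Nat.cast_prod,
    Nat.cast_prod, hbox]
  exact ovl_fraction n (2 ^ ℓ) (2 ^ m) (Nat.two_pow_pos ℓ) (Nat.two_pow_pos m) _ _ z₀ w hz hw hws
    (fun i => ovl_shift_card_real (2 ^ ℓ) (z₀ i)) (fun i => ovl_shift_card_real (2 ^ m) (w i))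

end Summit.PneNP.PneNP.Cruxes.PeaThreeNotInP.LatticeLine
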